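import Literature.NumberTheory.Automorphic.ArchRankinSelbergMirabolic
import HarnessLib

/-!
# `Ψ_∞(1; W, W̄, Φ) < ∞` from the boundedness of the Kirillov norms of translates (mirabolic reduction)

Topic `NumberTheory/Automorphic`; namespace `Literature.NumberTheory.Automorphic`. Theorems only. The
classical proof of the absolute convergence at `s = 1` of the archimedean Rankin–Selberg integral
`Ψ_∞(1; W, W̄, Φ) = ∫_{N_n\G_n} |W(g)|² Φ(e_n g) |det g| dg` for `W` in the Whittaker model of a
unitary generic representation (Jacquet–Shalika (1981), §1 and §3; Cogdell (2004), §3): fibre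
`N_n \ G_n` over `P'_n \ G_n` (`P'_n = Z_n P_n`),

  `Ψ_∞(1; W, W̄, Φ) = ∫_{P'_n \ G_n} Φ(e_n g) |det g| · ‖τ(g) e‖²_{Kir} dġ`,
  `‖v‖²_{Kir} = ∫_{N_{n-1} \ GL_{n-1}} |ℓ(τ(diag(h, 1)) v)|² dh`,

so that `Ψ_∞ < ∞` as soon as the Kirillov norms of all translates `τ(g) e` are bounded (which is the
case, with equality `‖τ(g) e‖²_{Kir} = c ‖e‖²`, by the unitarity of the Kirillov model of a unitary
generic representation — Jacquet–Shalika's theorem, NOT proved here). This file proves the REDUCTION,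
in the tree's Iwasawa coordinates (`archRankinSelbergLIntegral`, `ArchRankinSelbergConvergence`):

* `archRankinSelbergLIntegral_lt_top_of_kirillovBound` — in rank `m + 1`: if for all Haar measures
  on `(K_∞ˣ)^m × K_m` the Kirillov integrals
  `∫ |ℓ(τ(diag(diag(u) k', 1) g) e)|² δ_{B_m}(u)⁻¹ d(u, k')` are bounded by a finite constant
  uniformly in `g ∈ G_{m+1}` (hypothesis `hKir`, spelled out), then
  `archRankinSelbergLIntegral hcpt τ hτ ℓ e μA μK < ∞` for all Haar measures `μA`, `μK`;
* `archRankinSelbergLIntegral_lt_top_zero` — rank `0` (a point; any finite measures);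
* the measure-theoretic steps `lintegral_kinf_fibre_le` (the `K`-fibre `k ↦ diag(k', 1) k` averaged
  over `k' ∈ K_m`) and `measurePreserving_mirabolicCoords` (the mirabolic coordinates
  `((t, k), (u, k')) ↦ (k', ((t u, t), k))` preserve the Haar measures), and the pointwise bound
  `archRankinSelbergIntegrand_mirabolicCoords_le`.

The proof is measurability-free (only `lintegral_prod_le`, `lintegral_map_le` along measure-preserving
maps, Haar uniqueness and invariance are used; `ℓ ∘ τ(·) e` need not be measurable): Haar uniqueness
`μA = c • ⨂ d^×y_i`; the splitting `y = (t u, t)` (`measurePreserving_piFinSuccAbove` and the shear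
`u ↦ t u`); the `K`-fibre `k ↦ diag(k', 1) k` averaged over `k' ∈ K_m`; the pointwise identities of
`ArchRankinSelbergMirabolic` (`diag(t u, t) diag(k', 1) k = diag(diag(u) k', 1) · (t 1_n) k`,
`|det y| δ⁻¹ = N(t)^{m+1} δ_{B_m}(u)⁻¹`, `Φ_∞ ≤ e^{-c‖t‖²}`, `∫ N(t)^{m+1} e^{-c‖t‖²} d^×t < ∞`).
Everything is proved; the only definitions are the maps `kinfCornerSucc` (`k' ↦ diag(k', 1)` on `K_m`)
and `mirabolicCoords`; no named fact.

## References

* H. Jacquet, J. A. Shalika, *On Euler products and the classification of automorphic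
  representations I*, Amer. J. Math. 103 (1981), §1, §3 [JacquetShalikaAJM1981].
* J. W. Cogdell, *Analytic theory of L-functions for GL_n* (2004), §2.2, §3.1–§3.2 [CogdellAnalyticTheory2004].
-/

noncomputable section

open MeasureTheory Measure NumberField NumberField.mixedEmbedding IsDedekindDomain Set Filter
open scoped MatrixGroups ENNReal NNReal Classical Topology

namespace Literature.NumberTheory.Automorphic

variable {m : ℕ} {K : Type} [Field K] [NumberField K]

attribute [local instance] glInfBorel borelSpace_glInf locallyCompactSpace_glInf secondCountableTopology_glInf
  Literature.MeasureTheory.Group.Units.borelSpace_of_isOpenEmbedding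
  Literature.MeasureTheory.Group.hasSummableGeomSeries_of_finiteDimensional

/-! ### 1. Instances -/

section Instances

/-- `K_m = K_∞ ∩ GL_m` is a compact space. [folklore] -/
theorem compactSpace_Kinf (n : ℕ) : CompactSpace ↥(Kinf n K) :=
  isCompact_iff_compactSpace.1 (isCompact_Kinf_holds n K)

/-- The Borel structure of `(K_∞ˣ)ⁿ` (as in `ArchTorusPushforward.borelSpace_pi_mixedUnits`). [folklore] -/
private theorem borelSpace_pi_mixedUnits' (n : ℕ) : BorelSpace (Fin n → (mixedSpace K)ˣ) := by
  haveI hB : BorelSpace ((mixedSpace K)ˣ) := inferInstance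
  haveI hS : SecondCountableTopology ((mixedSpace K)ˣ) := inferInstance
  exact @Pi.borelSpace (Fin n) (fun _ => (mixedSpace K)ˣ) _ _ _ (fun _ => hS) (fun _ => hB)

/-- Multiplication on `(K_∞ˣ)ⁿ` is measurable. [folklore] -/
private theorem measurableMul_pi_mixedUnits' (n : ℕ) : MeasurableMul (Fin n → (mixedSpace K)ˣ) := by
  haveI := borelSpace_pi_mixedUnits' (K := K) n
  exact ContinuousMul.measurableMul


/-- Measurability of the multiplication of `K_∞ˣ` (recorded as theorems and local instances: instance
search does not assemble these by itself in the configurations below). [folklore] -/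
private theorem measurableMul_mixedUnits' : MeasurableMul ((mixedSpace K)ˣ) := ContinuousMul.measurableMul

/-- Binary measurability of the multiplication of `K_∞ˣ`. [folklore] -/
private theorem measurableMul₂_mixedUnits' : MeasurableMul₂ ((mixedSpace K)ˣ) := ContinuousMul.measurableMul₂

/-- `K_n ⊆ GL_n(K_∞)` is second countable. [folklore] -/
private theorem secondCountableTopology_Kinf' (n : ℕ) : SecondCountableTopology ↥(Kinf n K) :=
  TopologicalSpace.Subtype.secondCountableTopology _

/-- The Borel structure of `K_n`. [folklore] -/
private theorem borelSpace_Kinf' (n : ℕ) : BorelSpace ↥(Kinf n K) := inferInstance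

/-- Binary measurability of the multiplication of `K_n`. [folklore] -/
private theorem measurableMul₂_Kinf' (n : ℕ) : MeasurableMul₂ ↥(Kinf n K) := by
  haveI := secondCountableTopology_Kinf' (K := K) n
  exact ContinuousMul.measurableMul₂

/-- Measurability of the multiplication of `K_n`. [folklore] -/
private theorem measurableMul_Kinf' (n : ℕ) : MeasurableMul ↥(Kinf n K) := ContinuousMul.measurableMul

end Instances

attribute [local instance] borelSpace_pi_mixedUnits' measurableMul_pi_mixedUnits' measurableMul_mixedUnits'
  measurableMul₂_mixedUnits' secondCountableTopology_Kinf' borelSpace_Kinf' measurableMul₂_Kinf' measurableMul_Kinf'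

/-! ### 2. The corner embedding on `K_m` and the shear maps -/

section Maps

/-- `k' ↦ diag(k', 1)` as a map `K_m → K_{m+1}` (`cornerSucc_mem_Kinf`). [folklore] -/
def kinfCornerSucc (k' : ↥(Kinf m K)) : ↥(Kinf (m + 1) K) :=
  ⟨GLn.cornerSucc (mixedSpace K) (k' : GL (Fin m) (mixedSpace K)), cornerSucc_mem_Kinf _ _ k'.2⟩

/-- The underlying element of `kinfCornerSucc k'` is `diag(k', 1)`. [folklore] -/
@[simp] theorem coe_kinfCornerSucc (k' : ↥(Kinf m K)) :
    ((kinfCornerSucc k' : ↥(Kinf (m + 1) K)) : GL (Fin (m + 1)) (mixedSpace K)) =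
      GLn.cornerSucc (mixedSpace K) (k' : GL (Fin m) (mixedSpace K)) := rfl

omit [NumberField K] in
/-- `A ↦ diag(A, 1)` is continuous on matrices. [folklore] -/
theorem continuous_cornerSuccMatrix :
    Continuous fun A : Matrix (Fin m) (Fin m) (mixedSpace K) => cornerSuccMatrix A := by
  refine continuous_matrix fun i j => ?_
  rcases Fin.eq_castSucc_or_eq_last i with ⟨i, rfl⟩ | rfl <;>
    rcases Fin.eq_castSucc_or_eq_last j with ⟨j, rfl⟩ | rfl
  · simp only [cornerSuccMatrix_apply_castSucc_castSucc]; exact Continuous.matrix_elem continuous_id i j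
  · simp only [cornerSuccMatrix_apply_castSucc_last]; exact continuous_const
  · simp only [cornerSuccMatrix_apply_last_castSucc]; exact continuous_const
  · simp only [cornerSuccMatrix_apply_last_last]; exact continuous_const

omit [NumberField K] in
/-- The corner embedding `GL_m(K_∞) → GL_{m+1}(K_∞)` is continuous. [folklore] -/
theorem continuous_cornerSucc :
    Continuous (GLn.cornerSucc (mixedSpace K) : GL (Fin m) (mixedSpace K) → GL (Fin (m + 1)) (mixedSpace K)) := by
  refine Units.continuous_iff.2 ⟨continuous_cornerSuccMatrix.comp Units.continuous_val, ?_⟩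
  have h2 : (fun g : GL (Fin m) (mixedSpace K) => ((GLn.cornerSucc (mixedSpace K) g)⁻¹ :
      GL (Fin (m + 1)) (mixedSpace K)).val) = fun g => cornerSuccMatrix ((g⁻¹ : GL (Fin m) (mixedSpace K)) :
        Matrix (Fin m) (Fin m) (mixedSpace K)) := by
    funext g; rw [← map_inv]; rfl
  rw [h2]
  exact continuous_cornerSuccMatrix.comp Units.continuous_coe_inv

/-- Continuity of `k' ↦ diag(k', 1)` on `K_m`. [folklore] -/
theorem continuous_kinfCornerSucc : Continuous (kinfCornerSucc (m := m) (K := K)) :=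
  Continuous.subtype_mk (continuous_cornerSucc.comp continuous_subtype_val) _

/-- `(piFinSuccAbove _ last)⁻¹ (t, y') = (y', t)` as the tuple `insertNth last t y'`. [folklore] -/
theorem piFinSuccAbove_last_symm_apply {α : Type*} [MeasurableSpace α] (t : α) (y' : Fin m → α) :
    (MeasurableEquiv.piFinSuccAbove (fun _ => α) (Fin.last m)).symm (t, y') = Fin.insertNth (Fin.last m) t y' := by
  simp [MeasurableEquiv.piFinSuccAbove, Fin.insertNthEquiv]

end Maps

/-! ### 3. Measure-theoretic steps (no representation theory) -/

section Steps

/-- **The `K`-fibre, averaged**: for `F ≥ 0` on `Y × K_{m+1}`, a left-invariant `μK` and any finite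
measure `μK'` on `K_m`,
`μK'(K_m) ∫ F d(μY × μK) ≤ ∫ F(y, diag(k', 1) k) d(μK' × (μY × μK))(k', (y, k))`
(in fact equality; only `lintegral_map_le` along the measure-preserving shear
`(k', (y, k)) ↦ (k', (y, diag(k', 1) k))` and `map snd (μK' × ν) = μK'(univ) • ν` are used, so no
measurability of `F` is needed). [folklore] -/
theorem lintegral_kinf_fibre_le {Y : Type*} [MeasurableSpace Y] (μY : Measure Y) [SFinite μY]
    (μK : Measure ↥(Kinf (m + 1) K)) [SFinite μK] [μK.IsMulLeftInvariant]
    (μK' : Measure ↥(Kinf m K)) [SFinite μK'] (F : Y × ↥(Kinf (m + 1) K) → ℝ≥0∞) :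
    μK' univ * ∫⁻ p, F p ∂(μY.prod μK) ≤
      ∫⁻ q : ↥(Kinf m K) × (Y × ↥(Kinf (m + 1) K)), F (q.2.1, kinfCornerSucc q.1 * q.2.2) ∂(μK'.prod (μY.prod μK)) := by
  set Θ : ↥(Kinf m K) × (Y × ↥(Kinf (m + 1) K)) → ↥(Kinf m K) × (Y × ↥(Kinf (m + 1) K)) :=
    fun q => (q.1, (q.2.1, kinfCornerSucc q.1 * q.2.2)) with hΘ
  have hΘ : MeasurePreserving Θ (μK'.prod (μY.prod μK)) (μK'.prod (μY.prod μK)) := by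
    refine (MeasurePreserving.id μK').skew_product
      (g := fun (k' : ↥(Kinf m K)) (p : Y × ↥(Kinf (m + 1) K)) => (p.1, kinfCornerSucc k' * p.2)) ?_
      (ae_of_all _ fun k' => ?_)
    · exact measurable_snd.fst.prodMk
        ((continuous_kinfCornerSucc.measurable.comp measurable_fst).mul measurable_snd.snd)
    · exact ((MeasurePreserving.id μY).prod (measurePreserving_mul_left μK (kinfCornerSucc k'))).map_eq
  calc μK' univ * ∫⁻ p, F p ∂(μY.prod μK) = ∫⁻ p, F p ∂(μK' univ • μY.prod μK) := by
        rw [lintegral_smul_measure, smul_eq_mul]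
    _ = ∫⁻ p, F p ∂(Measure.map Prod.snd (μK'.prod (μY.prod μK))) := by rw [Measure.map_snd_prod]
    _ ≤ ∫⁻ q, F q.2 ∂(μK'.prod (μY.prod μK)) := lintegral_map_le _ _
    _ = ∫⁻ q, F q.2 ∂(Measure.map Θ (μK'.prod (μY.prod μK))) := by rw [hΘ.map_eq]
    _ ≤ ∫⁻ q, F (Θ q).2 ∂(μK'.prod (μY.prod μK)) := lintegral_map_le _ _

/-- The mirabolic coordinates `((t, k), (u, k')) ↦ (k', ((t u, t), k))`. [folklore] -/
def mirabolicCoords (r : ((mixedSpace K)ˣ × ↥(Kinf (m + 1) K)) × ((Fin m → (mixedSpace K)ˣ) × ↥(Kinf m K))) :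
    ↥(Kinf m K) × ((Fin (m + 1) → (mixedSpace K)ˣ) × ↥(Kinf (m + 1) K)) :=
  (r.2.2, (Fin.insertNth (Fin.last m) r.1.1 (fun i => r.1.1 * r.2.1 i), r.1.2))

/-- **The mirabolic coordinates preserve the Haar measures**:
`((t, k), (u, k')) ↦ (k', ((t u, t), k))` carries `(d^×t × μK) × (⨂ d^×u_i × μK')` to
`μK' × (⨂ d^×y_i × μK)` (the shear `u ↦ t u` by the invariance of `⨂ d^×u_i`, the splitting of the last
coordinate by `measurePreserving_piFinSuccAbove`, and reshuffling of the factors). [folklore] -/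
theorem measurePreserving_mirabolicCoords (μ₁ : Measure (mixedSpace K)ˣ) [SigmaFinite μ₁] [μ₁.IsMulLeftInvariant]
    (μK : Measure ↥(Kinf (m + 1) K)) [SFinite μK] (μK' : Measure ↥(Kinf m K)) [SFinite μK'] :
    MeasurePreserving (mirabolicCoords (m := m) (K := K))
      ((μ₁.prod μK).prod ((Measure.pi fun _ : Fin m => μ₁).prod μK'))
      (μK'.prod ((Measure.pi fun _ : Fin (m + 1) => μ₁).prod μK)) := by
  haveI : ∀ i : Fin m, MeasurableMul ((mixedSpace K)ˣ) := fun _ => measurableMul_mixedUnits'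
  haveI : ∀ i : Fin (m + 1), MeasurableMul ((mixedSpace K)ˣ) := fun _ => measurableMul_mixedUnits'
  set μπ : Measure (Fin (m + 1) → (mixedSpace K)ˣ) := Measure.pi fun _ => μ₁ with hμπ
  set μπ' : Measure (Fin m → (mixedSpace K)ˣ) := Measure.pi fun _ => μ₁ with hμπ'
  haveI : SigmaFinite μπ := by rw [hμπ]; infer_instance
  haveI : SigmaFinite μπ' := by rw [hμπ']; infer_instance
  haveI : μπ'.IsMulLeftInvariant := by rw [hμπ']; infer_instance
  set ρ := (μ₁.prod μK).prod (μπ'.prod μK') with hρ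
  -- shear `u ↦ t u`
  have hσ : MeasurePreserving
      (fun r : ((mixedSpace K)ˣ × ↥(Kinf (m + 1) K)) × ((Fin m → (mixedSpace K)ˣ) × ↥(Kinf m K)) =>
        (r.1, ((fun _ => r.1.1) * r.2.1, r.2.2))) ρ ρ := by
    refine (MeasurePreserving.id (μ₁.prod μK)).skew_product
      (g := fun (a : (mixedSpace K)ˣ × ↥(Kinf (m + 1) K)) (p : (Fin m → (mixedSpace K)ˣ) × ↥(Kinf m K)) =>
        ((fun _ => a.1) * p.1, p.2)) ?_ (ae_of_all _ fun a => ?_)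
    · haveI : ∀ i : Fin m, MeasurableMul₂ ((mixedSpace K)ˣ) := fun _ => measurableMul₂_mixedUnits'
      exact ((measurable_pi_iff.2 fun _ => measurable_fst.fst).mul measurable_snd.fst).prodMk
        measurable_snd.snd
    · exact ((measurePreserving_mul_left μπ' (fun _ => a.1)).prod (MeasurePreserving.id μK')).map_eq
  -- reshuffle `((t, k), (y', k')) ↦ (k', ((t, y'), k))`
  have hπ : MeasurePreserving
      (fun r : ((mixedSpace K)ˣ × ↥(Kinf (m + 1) K)) × ((Fin m → (mixedSpace K)ˣ) × ↥(Kinf m K)) =>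
        (r.2.2, ((r.1.1, r.2.1), r.1.2))) ρ (μK'.prod ((μ₁.prod μπ').prod μK)) := by
    have p1 : MeasurePreserving (Prod.map id Prod.swap) ρ ((μ₁.prod μK).prod (μK'.prod μπ')) :=
      (MeasurePreserving.id _).prod measurePreserving_swap
    have p2 : MeasurePreserving Prod.swap ((μ₁.prod μK).prod (μK'.prod μπ')) ((μK'.prod μπ').prod (μ₁.prod μK)) :=
      measurePreserving_swap
    have p3 := measurePreserving_prodAssoc μK' μπ' (μ₁.prod μK)
    have p4a := (measurePreserving_prodAssoc μπ' μ₁ μK).symm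
    have p4b : MeasurePreserving (Prod.map Prod.swap id) ((μπ'.prod μ₁).prod μK) ((μ₁.prod μπ').prod μK) :=
      measurePreserving_swap.prod (MeasurePreserving.id _)
    have p4 : MeasurePreserving (Prod.map id ((Prod.map Prod.swap id) ∘ (MeasurableEquiv.prodAssoc.symm)))
        (μK'.prod (μπ'.prod (μ₁.prod μK))) (μK'.prod ((μ₁.prod μπ').prod μK)) :=
      (MeasurePreserving.id _).prod (p4b.comp p4a)
    exact ((p4.comp p3).comp p2).comp p1
  -- `(t, y') ↦ y = insertNth last t y'`
  set eFin := MeasurableEquiv.piFinSuccAbove (fun _ : Fin (m + 1) => (mixedSpace K)ˣ) (Fin.last m) with heFin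
  have hε : MeasurePreserving (Prod.map id (Prod.map eFin.symm id))
      (μK'.prod ((μ₁.prod μπ').prod μK)) (μK'.prod (μπ.prod μK)) := by
    refine (MeasurePreserving.id _).prod (MeasurePreserving.prod ?_ (MeasurePreserving.id _))
    exact (measurePreserving_piFinSuccAbove (fun _ : Fin (m + 1) => μ₁) (Fin.last m)).symm
  have hcomp := (hε.comp hπ).comp hσ
  have hfun : (mirabolicCoords (m := m) (K := K)) = ((Prod.map id (Prod.map eFin.symm id)) ∘
      (fun r : ((mixedSpace K)ˣ × ↥(Kinf (m + 1) K)) × ((Fin m → (mixedSpace K)ˣ) × ↥(Kinf m K)) =>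
          (r.2.2, ((r.1.1, r.2.1), r.1.2)))) ∘
        fun r : ((mixedSpace K)ˣ × ↥(Kinf (m + 1) K)) × ((Fin m → (mixedSpace K)ˣ) × ↥(Kinf m K)) =>
          (r.1, ((fun _ => r.1.1) * r.2.1, r.2.2)) := by
    funext r
    rcases r with ⟨⟨t, k⟩, ⟨u, k'⟩⟩
    simp only [Function.comp_apply, Prod.map_apply, id_eq, mirabolicCoords]
    rw [heFin, piFinSuccAbove_last_symm_apply]
    rfl
  rw [hfun]
  exact hcomp

end Steps

/-! ### 4. The reduction in rank `m + 1` -/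

section Reduction

variable (hcpt : isCompact_glFiniteIntegralLevel (m + 1) K)
  {E : Type*} [NormedAddCommGroup E] [NormedSpace ℂ E] [CompleteSpace E]
  (τ : ContRepresentation ℂ (AutomorphyDatum.gl (m + 1) K hcpt).arch.carrier E) (hτ : τ.IsStronglyContinuous)

/-- **The integrand in mirabolic coordinates**: at `y = (t u, t)` and `k₂ = diag(k', 1) k`,
`|ℓ(τ(diag(y) k₂) e)|² Φ_∞(e_n diag(y) k₂) |det y| δ⁻¹(y) ≤
 (|ℓ(τ(diag(diag(u) k', 1) · (t 1) k) e)|² δ_{B_m}(u)⁻¹) · (N(t)^{m+1} e^{-c‖t‖²})`. [folklore] -/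
theorem archRankinSelbergIntegrand_mirabolicCoords_le (ℓ : archGardingSpace hcpt τ →ₗ[ℂ] ℂ)
    (e : archGardingSpace hcpt τ) {c : ℝ}
    (hgauss : ∀ (t : (mixedSpace K)ˣ) (u : Fin m → (mixedSpace K)ˣ) (k : GL (Fin (m + 1)) (mixedSpace K)),
      k ∈ Kinf (m + 1) K →
      gaussArchTestFun (m + 1) K (archLastRow (m + 1) K
        (glDiagonal (m + 1) (mixedSpace K) (Fin.insertNth (Fin.last m) t (fun i => t * u i)) * k)) ≤
      Real.exp (-(c * ‖(t : mixedSpace K)‖ ^ 2)))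
    (t : (mixedSpace K)ˣ) (k : ↥(Kinf (m + 1) K)) (u : Fin m → (mixedSpace K)ˣ) (k' : ↥(Kinf m K)) :
    ‖ℓ ⟨τ (toArch hcpt (glDiagonal (m + 1) (mixedSpace K) (Fin.insertNth (Fin.last m) t (fun i => t * u i)) *
        ((kinfCornerSucc k' * k : ↥(Kinf (m + 1) K)) : GL (Fin (m + 1)) (mixedSpace K)))) (e : E),
        apply_mem_archGardingSpace hτ _ e.2⟩‖ₑ ^ 2 *
      ENNReal.ofReal (gaussArchTestFun (m + 1) K (archLastRow (m + 1) K
        (glDiagonal (m + 1) (mixedSpace K) (Fin.insertNth (Fin.last m) t (fun i => t * u i)) *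
          ((kinfCornerSucc k' * k : ↥(Kinf (m + 1) K)) : GL (Fin (m + 1)) (mixedSpace K)))) *
        archTorusWeight (m + 1) K 1 (Fin.insertNth (Fin.last m) t (fun i => t * u i))) ≤
    (‖ℓ ⟨τ (toArch hcpt (GLn.cornerSucc (mixedSpace K)
        (glDiagonal m (mixedSpace K) u * (k' : GL (Fin m) (mixedSpace K))) *
        (glDiagonal (m + 1) (mixedSpace K) (fun _ => t) * (k : GL (Fin (m + 1)) (mixedSpace K))))) (e : E),
        apply_mem_archGardingSpace hτ _ e.2⟩‖ₑ ^ 2 * ENNReal.ofReal (archTorusWeight m K 0 u)) *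
      ENNReal.ofReal (mixedEmbedding.norm ((t : (mixedSpace K)ˣ) : mixedSpace K) ^ ((m : ℝ) + 1) *
        Real.exp (-(c * ‖((t : (mixedSpace K)ˣ) : mixedSpace K)‖ ^ 2))) := by
  -- the group element
  have hg : glDiagonal (m + 1) (mixedSpace K) (Fin.insertNth (Fin.last m) t (fun i => t * u i)) *
      ((kinfCornerSucc k' * k : ↥(Kinf (m + 1) K)) : GL (Fin (m + 1)) (mixedSpace K)) =
      GLn.cornerSucc (mixedSpace K) (glDiagonal m (mixedSpace K) u * (k' : GL (Fin m) (mixedSpace K))) *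
        (glDiagonal (m + 1) (mixedSpace K) (fun _ => t) * (k : GL (Fin (m + 1)) (mixedSpace K))) := by
    rw [glDiagonal_insertNth_eq, Subgroup.coe_mul, coe_kinfCornerSucc, map_mul]
    simp only [mul_assoc]
    rw [← mul_assoc (glDiagonal (m + 1) (mixedSpace K) fun _ => t), glScalar_mul_comm, mul_assoc]
  have hk2 : ((kinfCornerSucc k' * k : ↥(Kinf (m + 1) K)) : GL (Fin (m + 1)) (mixedSpace K)) ∈ Kinf (m + 1) K :=
    (kinfCornerSucc k' * k).2
  have hG := hgauss t u _ hk2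
  rw [hg] at hG ⊢
  rw [archTorusWeight_insertNth_eq, mul_assoc]
  refine mul_le_mul' le_rfl ?_
  have hw0 : 0 ≤ archTorusWeight m K 0 u := by
    unfold archTorusWeight
    exact Finset.prod_nonneg fun i _ => Real.rpow_nonneg (mixedEmbedding.norm_nonneg _) _
  have hN0 : 0 ≤ mixedEmbedding.norm ((t : (mixedSpace K)ˣ) : mixedSpace K) ^ ((m : ℝ) + 1) :=
    Real.rpow_nonneg (mixedEmbedding.norm_nonneg _) _
  rw [← ENNReal.ofReal_mul hw0]
  refine ENNReal.ofReal_le_ofReal ?_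
  calc gaussArchTestFun (m + 1) K (archLastRow (m + 1) K (GLn.cornerSucc (mixedSpace K)
        (glDiagonal m (mixedSpace K) u * (k' : GL (Fin m) (mixedSpace K))) *
        (glDiagonal (m + 1) (mixedSpace K) (fun _ => t) * (k : GL (Fin (m + 1)) (mixedSpace K))))) *
        (mixedEmbedding.norm ((t : (mixedSpace K)ˣ) : mixedSpace K) ^ ((m : ℝ) + 1) * archTorusWeight m K 0 u)
      ≤ Real.exp (-(c * ‖((t : (mixedSpace K)ˣ) : mixedSpace K)‖ ^ 2)) *
        (mixedEmbedding.norm ((t : (mixedSpace K)ˣ) : mixedSpace K) ^ ((m : ℝ) + 1) * archTorusWeight m K 0 u) :=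
        mul_le_mul_of_nonneg_right hG (mul_nonneg hN0 hw0)
    _ = archTorusWeight m K 0 u * (mixedEmbedding.norm ((t : (mixedSpace K)ˣ) : mixedSpace K) ^ ((m : ℝ) + 1) *
        Real.exp (-(c * ‖((t : (mixedSpace K)ˣ) : mixedSpace K)‖ ^ 2))) := by ring

/-- **`Ψ_∞(1; W, W̄, Φ^{Gauss}) < ∞` from a uniform bound for the Kirillov integrals of the translates
`τ(g) e`** (rank `m + 1`; the mirabolic reduction of Jacquet–Shalika (1981), §3, in the Iwasawa
coordinates of `archRankinSelbergLIntegral`): if for all Haar measures `μ'` on `(K_∞ˣ)^m` and `μK'` on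
`K_m` there is a finite `C` with
`∫ |ℓ(τ(diag(diag(u) k', 1) g) e)|² δ_{B_m}(u)⁻¹ d(μ' × μK')(u, k') ≤ C` for every `g ∈ GL_{m+1}(K_∞)`
(`δ_{B_m}(u)⁻¹ = archTorusWeight m K 0 u`, the Iwasawa weight of `N_m \ GL_m`), then
`archRankinSelbergLIntegral hcpt τ hτ ℓ e μA μK < ∞` for all Haar measures `μA`, `μK`.
[cite: JacquetShalikaAJM1981, §3] [cite: CogdellAnalyticTheory2004, §2.2 and §3.1–§3.2] -/
theorem archRankinSelbergLIntegral_lt_top_of_kirillovBound (ℓ : archGardingSpace hcpt τ →ₗ[ℂ] ℂ)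
    (e : archGardingSpace hcpt τ)
    (hKir : ∀ (μ' : Measure (Fin m → (mixedSpace K)ˣ)) [IsHaarMeasure μ'] (μK' : Measure ↥(Kinf m K))
      [IsHaarMeasure μK'], ∃ C : ℝ≥0∞, C ≠ ⊤ ∧ ∀ g : GL (Fin (m + 1)) (mixedSpace K),
        ∫⁻ p : (Fin m → (mixedSpace K)ˣ) × ↥(Kinf m K),
          ‖ℓ ⟨τ (toArch hcpt (GLn.cornerSucc (mixedSpace K)
              (glDiagonal m (mixedSpace K) p.1 * (p.2 : GL (Fin m) (mixedSpace K))) * g)) (e : E),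
            apply_mem_archGardingSpace hτ _ e.2⟩‖ₑ ^ 2 *
            ENNReal.ofReal (archTorusWeight m K 0 p.1) ∂(μ'.prod μK') ≤ C)
    (μA : Measure (Fin (m + 1) → (mixedSpace K)ˣ)) [IsHaarMeasure μA]
    (μK : Measure ↥(Kinf (m + 1) K)) [IsHaarMeasure μK] :
    archRankinSelbergLIntegral hcpt τ hτ ℓ e μA μK < ⊤ := by
  haveI : CompactSpace ↥(Kinf (m + 1) K) := compactSpace_Kinf (m + 1)
  haveI : CompactSpace ↥(Kinf m K) := compactSpace_Kinf m
  haveI : ∀ i : Fin m, MeasurableMul ((mixedSpace K)ˣ) := fun _ => measurableMul_mixedUnits'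
  haveI : ∀ i : Fin (m + 1), MeasurableMul ((mixedSpace K)ˣ) := fun _ => measurableMul_mixedUnits'
  haveI : IsFiniteMeasure μK := by infer_instance
  -- the measures
  set μ₁ : Measure (mixedSpace K)ˣ := mixedUnitsHaar K with hμ₁
  haveI : IsHaarMeasure μ₁ := by rw [hμ₁]; infer_instance
  haveI : SigmaFinite μ₁ := by rw [hμ₁]; infer_instance
  set μπ : Measure (Fin (m + 1) → (mixedSpace K)ˣ) := Measure.pi fun _ => μ₁ with hμπ
  set μπ' : Measure (Fin m → (mixedSpace K)ˣ) := Measure.pi fun _ => μ₁ with hμπ'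
  haveI : IsHaarMeasure μπ := by rw [hμπ]; infer_instance
  haveI : SigmaFinite μπ := by rw [hμπ]; infer_instance
  haveI : IsHaarMeasure μπ' := by rw [hμπ']; infer_instance
  haveI : SigmaFinite μπ' := by rw [hμπ']; infer_instance
  set μK' : Measure ↥(Kinf m K) := Measure.haar with hμK'
  haveI : IsHaarMeasure μK' := by rw [hμK']; infer_instance
  haveI : IsFiniteMeasure μK' := by infer_instance
  -- the integrand
  set F : (Fin (m + 1) → (mixedSpace K)ˣ) × ↥(Kinf (m + 1) K) → ℝ≥0∞ := fun p =>
    ‖ℓ ⟨τ (toArch hcpt (glDiagonal (m + 1) (mixedSpace K) p.1 * (p.2 : GL (Fin (m + 1)) (mixedSpace K)))) (e : E),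
        apply_mem_archGardingSpace hτ _ e.2⟩‖ₑ ^ 2 *
      ENNReal.ofReal (gaussArchTestFun (m + 1) K (archLastRow (m + 1) K
        (glDiagonal (m + 1) (mixedSpace K) p.1 * (p.2 : GL (Fin (m + 1)) (mixedSpace K)))) *
          archTorusWeight (m + 1) K 1 p.1) with hF
  have hI : archRankinSelbergLIntegral hcpt τ hτ ℓ e μA μK = ∫⁻ p, F p ∂(μA.prod μK) := by
    rw [archRankinSelbergLIntegral_def]
  rw [hI]
  -- Step 1: Haar uniqueness `μA = c • ⨂ d^×y_i`
  have hμA : μA = haarScalarFactor μA μπ • μπ := isMulLeftInvariant_eq_smul μA μπ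
  have h1 : ∫⁻ p, F p ∂(μA.prod μK) = haarScalarFactor μA μπ • ∫⁻ p, F p ∂(μπ.prod μK) := by
    conv_lhs => rw [hμA]
    rw [Measure.prod_smul_left, lintegral_smul_measure]
  suffices h : ∫⁻ p, F p ∂(μπ.prod μK) < ⊤ by
    rw [h1, ENNReal.smul_def, smul_eq_mul]
    exact ENNReal.mul_lt_top ENNReal.coe_lt_top h
  -- Step 2 & 3: fibre over `K_m` and mirabolic coordinates
  have h2 := lintegral_kinf_fibre_le μπ μK μK' F
  have hΨ := measurePreserving_mirabolicCoords (m := m) (K := K) μ₁ μK μK'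
  set ρ := (μ₁.prod μK).prod (μπ'.prod μK') with hρ
  have h3 : ∫⁻ q : ↥(Kinf m K) × ((Fin (m + 1) → (mixedSpace K)ˣ) × ↥(Kinf (m + 1) K)),
      F (q.2.1, kinfCornerSucc q.1 * q.2.2) ∂(μK'.prod (μπ.prod μK)) ≤
      ∫⁻ r, F ((mirabolicCoords r).2.1, kinfCornerSucc (mirabolicCoords r).1 * (mirabolicCoords r).2.2) ∂ρ := by
    rw [← hΨ.map_eq]
    exact lintegral_map_le _ _
  -- Step 4: pointwise bound in the new coordinates
  obtain ⟨c, hc, hgauss⟩ := exists_gaussArchTestFun_diag_kinf_le (m := m) (K := K)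
  set cT : (mixedSpace K)ˣ × ↥(Kinf (m + 1) K) → ℝ≥0∞ := fun a =>
    ENNReal.ofReal (mixedEmbedding.norm ((a.1 : (mixedSpace K)ˣ) : mixedSpace K) ^ ((m : ℝ) + 1) *
      Real.exp (-(c * ‖((a.1 : (mixedSpace K)ˣ) : mixedSpace K)‖ ^ 2))) with hcT
  set gT : (mixedSpace K)ˣ × ↥(Kinf (m + 1) K) → GL (Fin (m + 1)) (mixedSpace K) := fun a =>
    glDiagonal (m + 1) (mixedSpace K) (fun _ => a.1) * (a.2 : GL (Fin (m + 1)) (mixedSpace K)) with hgT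
  set B : ((Fin m → (mixedSpace K)ˣ) × ↥(Kinf m K)) → ((mixedSpace K)ˣ × ↥(Kinf (m + 1) K)) → ℝ≥0∞ :=
    fun b a => ‖ℓ ⟨τ (toArch hcpt (GLn.cornerSucc (mixedSpace K)
      (glDiagonal m (mixedSpace K) b.1 * (b.2 : GL (Fin m) (mixedSpace K))) * gT a)) (e : E),
        apply_mem_archGardingSpace hτ _ e.2⟩‖ₑ ^ 2 * ENNReal.ofReal (archTorusWeight m K 0 b.1) with hB
  have hpt : ∀ r : ((mixedSpace K)ˣ × ↥(Kinf (m + 1) K)) × ((Fin m → (mixedSpace K)ˣ) × ↥(Kinf m K)),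
      F ((mirabolicCoords r).2.1, kinfCornerSucc (mirabolicCoords r).1 * (mirabolicCoords r).2.2) ≤
        B r.2 r.1 * cT r.1 := by
    rintro ⟨⟨t, k⟩, ⟨u, k'⟩⟩
    exact archRankinSelbergIntegrand_mirabolicCoords_le hcpt τ hτ ℓ e hgauss t k u k'
  -- Step 5: integrate
  obtain ⟨C, hCtop, hC⟩ := hKir μπ' μK'
  have hcT_top : ∀ a, cT a ≠ ⊤ := fun a => ENNReal.ofReal_ne_top
  have h5 : ∫⁻ r, F ((mirabolicCoords r).2.1, kinfCornerSucc (mirabolicCoords r).1 * (mirabolicCoords r).2.2) ∂ρ ≤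
      C * (μK univ * ∫⁻ t, cT (t, 1) ∂μ₁) := by
    calc ∫⁻ r, F ((mirabolicCoords r).2.1, kinfCornerSucc (mirabolicCoords r).1 * (mirabolicCoords r).2.2) ∂ρ
        ≤ ∫⁻ r, B r.2 r.1 * cT r.1 ∂ρ := lintegral_mono hpt
      _ ≤ ∫⁻ a, ∫⁻ b, B b a * cT a ∂(μπ'.prod μK') ∂(μ₁.prod μK) := lintegral_prod_le _
      _ = ∫⁻ a, (∫⁻ b, B b a ∂(μπ'.prod μK')) * cT a ∂(μ₁.prod μK) :=
          lintegral_congr fun a => lintegral_mul_const' _ _ (hcT_top a)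
      _ ≤ ∫⁻ a, C * cT a ∂(μ₁.prod μK) := lintegral_mono fun a => mul_le_mul' (hC (gT a)) le_rfl
      _ = C * ∫⁻ a, cT a ∂(μ₁.prod μK) := lintegral_const_mul' _ _ hCtop
      _ ≤ C * ∫⁻ t, ∫⁻ k, cT (t, k) ∂μK ∂μ₁ := mul_le_mul' le_rfl (lintegral_prod_le _)
      _ = C * ∫⁻ t, cT (t, 1) * μK univ ∂μ₁ := by
          congr 1
          refine lintegral_congr fun t => ?_
          rw [show (fun k : ↥(Kinf (m + 1) K) => cT (t, k)) = fun _ => cT (t, 1) from funext fun k => rfl,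
            lintegral_const]
      _ = C * (μK univ * ∫⁻ t, cT (t, 1) ∂μ₁) := by
          rw [lintegral_mul_const' _ _ (measure_ne_top μK _), mul_comm (∫⁻ t, cT (t, 1) ∂μ₁)]
  have hfin : ∫⁻ t, cT (t, 1) ∂μ₁ < ⊤ := lintegral_units_norm_rpow_mul_exp_neg_lt_top hc m
  have htot : μK' univ * ∫⁻ p, F p ∂(μπ.prod μK) < ⊤ :=
    lt_of_le_of_lt (h2.trans (h3.trans h5))
      (ENNReal.mul_lt_top hCtop.lt_top (ENNReal.mul_lt_top (measure_lt_top μK _) hfin))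
  -- Step 6: conclude (`μK'(K_m) ≠ 0`)
  have hK'0 : μK' univ ≠ 0 := (isOpen_univ.measure_pos μK' univ_nonempty).ne'
  rw [ENNReal.mul_lt_top_iff] at htot
  rcases htot with ⟨-, h⟩ | h | h
  · exact h
  · exact absurd h hK'0
  · rw [h]; exact ENNReal.zero_lt_top

end Reduction

/-! ### 5. Rank `0` -/

section RankZero

variable (hcpt : isCompact_glFiniteIntegralLevel 0 K)
  {E : Type*} [NormedAddCommGroup E] [NormedSpace ℂ E] [CompleteSpace E]
  (τ : ContRepresentation ℂ (AutomorphyDatum.gl 0 K hcpt).arch.carrier E) (hτ : τ.IsStronglyContinuous)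

/-- In rank `0` the archimedean Rankin–Selberg integral is over a point and is finite. [folklore] -/
theorem archRankinSelbergLIntegral_lt_top_zero (ℓ : archGardingSpace hcpt τ →ₗ[ℂ] ℂ) (e : archGardingSpace hcpt τ)
    (μA : Measure (Fin 0 → (mixedSpace K)ˣ)) [IsFiniteMeasure μA]
    (μK : Measure ↥(Kinf 0 K)) [IsFiniteMeasure μK] :
    archRankinSelbergLIntegral hcpt τ hτ ℓ e μA μK < ⊤ := by
  rw [archRankinSelbergLIntegral_def]
  set p₀ : (Fin 0 → (mixedSpace K)ˣ) × ↥(Kinf 0 K) := (fun i => Fin.elim0 i, 1) with hp₀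
  haveI : Subsingleton ((Fin 0 → (mixedSpace K)ˣ) × ↥(Kinf 0 K)) := by
    haveI : Subsingleton ↥(Kinf 0 K) := by
      refine ⟨fun a b => Subtype.ext (Matrix.GeneralLinearGroup.ext fun i _ => Fin.elim0 i)⟩
    infer_instance
  refine lt_of_le_of_lt (lintegral_mono (g := fun _ => (‖ℓ ⟨τ (toArch hcpt (glDiagonal 0 (mixedSpace K) p₀.1 *
      (p₀.2 : GL (Fin 0) (mixedSpace K)))) (e : E), apply_mem_archGardingSpace hτ _ e.2⟩‖ₑ ^ 2 *
      ENNReal.ofReal (gaussArchTestFun 0 K (archLastRow 0 K (glDiagonal 0 (mixedSpace K) p₀.1 *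
        (p₀.2 : GL (Fin 0) (mixedSpace K)))) * archTorusWeight 0 K 1 p₀.1))) fun p => ?_) ?_
  · rw [Subsingleton.elim p p₀]
  · rw [lintegral_const]
    exact ENNReal.mul_lt_top (ENNReal.mul_lt_top (ENNReal.pow_lt_top enorm_lt_top) ENNReal.ofReal_lt_top)
      (measure_lt_top _ _)

end RankZero

end Literature.NumberTheory.Automorphic
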